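import Summits.AtomisticToContinuum.Crystallization.Theorems.ChartedZeroExcessLayeredLatticeLiouvilleUR

/-!
# Zero-excess layered lattice Liouville — part US (lens-2 g57, node «LinearisationIdentity»): (PT) `LinearisationDefectP` PROVED.

Continuation of parts UQ/UR (critic row 889: «PROVE (PT) outright (S), then (HC)»).  This part closes the piece (PT) of the SB-glue
`subWindowBudgetBPG_of_pieces` (part UR): `linearisationDefectP_holds : LinearisationDefectP` — for a `δ`-separated Nash configuration `S`, a
co-Lipschitz layered set `H = Layered b₁ b₂ w` that is `27/32`-separated and Nash, a bijection `Ψ : S → H`, `ϱ > 0` and an index site `X`,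
`truncResidual ϱ (pullDisp S Ψ b₁ b₂ w) X + tailForce ϱ S H Ψ (Ψ⁻¹ (lsite X)) = −Σ_{Y ≠ X, ‖lsite Y − lsite X‖ ≤ ϱ} defectKernel (lsite X − lsite Y) (φ X − φ Y)`.
MECHANISM (pure bookkeeping, as announced in UQ.3): (1) part TF's `tailForce_eq_near_sub_near` (Newton + Nash on both sides) writes the tail force at
`x = Ψ⁻¹(lsite X)` as (near model force at `lsite X`) − (near source force at `x`), both `tsum`s over `E3`-subtypes; (2) both near sums and the
truncated residual are re-indexed over the FINITE near index set `{Y | ‖lsite Y − lsite X‖ ≤ ϱ}` (finite: co-Lipschitz ⇒ inside the index ball of radius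
`ϱ/c`; re-indexing through `lsite` (`injective_lsite_of_isLayeredCrystal`) on the model side and through `Y ↦ Ψ⁻¹(lsite Y)` (injective, onto `S`, by
`Set.BijOn`) on the source side: `tsum_near_layered_eq_sum`, `tsum_near_source_eq_sum`, `truncResidual_eq_sum`); (3) bond by bond,
`forceConst (lsite Y − lsite X) (φ Y − φ X) + pairForce (lsite X − lsite Y) − pairForce (x − Ψ⁻¹(lsite Y)) = −defectKernel (lsite X − lsite Y) (φ X − φ Y)`
because `x − Ψ⁻¹(lsite Y) = (lsite X − lsite Y) + (φ X − φ Y)` (`φ = pullDisp`) and `forceConst` is even (`forceConst_neg`, part B).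
LEAVES of [SBᵇ] after this part: (T) `TailDominationCert`, (LD) `LinearExcessDecayZ`, (HC) `HarmonicComparisonZ`, (RC) `EquilChartStrainP`, (I4ˢ) `TailFluxBSP`,
hU, hN and the two typed glues (UR); (PT) is struck, (I1) was PROVED in UP.  No statement of the column is re-typed here.
-/

noncomputable section

open scoped BigOperators InnerProductSpace RealInnerProductSpace
open MeasureTheory Set Metric Filter Topology
open Summit.AtomisticToContinuum.Crystallization.Theorems.ChartedPlanarOrderRigidityDoor (E3 IsNash atomsIn)
open Summit.AtomisticToContinuum.Crystallization.Theorems.ChartedPlanarOrderDensityDichotomy (μS IsSep nK nK_nonneg)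
open Summit.AtomisticToContinuum.Crystallization.Theorems.ChartedPlanarOrderMesoCut (LayeredHom)
open Summit.AtomisticToContinuum.Crystallization.Theorems.ChartedPlanarOrderDoorLayered (Layered layeredHom_eq_layered)
open Summit.AtomisticToContinuum.Crystallization.Theorems.ChartedPlanarOrderProfileSlavingLJ (pairForce)
open Summit.AtomisticToContinuum.Crystallization.Theorems.ChartedPlanarOrderProfileSlavingLJBalance (pairForce_neg)

namespace Summit.AtomisticToContinuum.Crystallization.Theorems.ChartedZeroExcessLayeredLatticeLiouville

/-! ### US.1  Finiteness and re-indexing of the near sums of a co-Lipschitz layered crystal -/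

section NearIndex

variable {c : ℝ} {a b : E3} {w : ℤ → E3}

/-- in a `c`-co-Lipschitz layered crystal the index sites whose model sites lie within `ϱ` of a given model site form a FINITE set (they lie in the
index ball of radius `ϱ / c`). [this file, g57] -/
theorem finite_near_lsite (hc : 0 < c) (h : IsLayeredCrystal c a b w) (X : Cell 2 × ℤ) (ϱ : ℝ) :
    {Y : Cell 2 × ℤ | ‖lsite a b w Y.1 Y.2 - lsite a b w X.1 X.2‖ ≤ ϱ}.Finite := by
  refine ((isCompact_closedBall X (ϱ / c)).finite_of_discrete).subset fun Y hY => ?_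
  rw [mem_closedBall, le_div_iff₀ hc, mul_comm]
  exact (h Y X).trans hY

/-- the layered kernel at the bond `X → Y`, read in absolute index coordinates: zero on the diagonal, else the force constant of the model bond. [this file, g57] -/
theorem layeredKernel_sub_fst_eq (a b : E3) (w : ℤ → E3) (X Y : Cell 2 × ℤ) :
    layeredKernel a b w (Y.1 - X.1) X.2 Y.2 =
      if Y = X then 0 else forceConst (lsite a b w Y.1 Y.2 - lsite a b w X.1 X.2) := by
  have hl : lsite a b w (Y.1 - X.1) Y.2 - lsite a b w 0 X.2 = lsite a b w Y.1 Y.2 - lsite a b w X.1 X.2 := by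
    simp only [lsite, Pi.sub_apply, Int.cast_sub, sub_smul, Pi.zero_apply, Int.cast_zero, zero_smul, zero_add]
    abel
  have hiff : (Y.1 - X.1 = 0 ∧ Y.2 = X.2) ↔ Y = X := by
    rw [sub_eq_zero, Prod.ext_iff]
  simp only [layeredKernel]
  rw [hl]
  exact if_congr hiff rfl rfl

/-- the truncated residual as an index `tsum` of force constants over the near sites `Y ≠ X` (no hypothesis). [this file, g57] -/
theorem truncResidual_eq_tsum_ite (ϱ : ℝ) (a b : E3) (w : ℤ → E3) (φ : Cell 2 → ℤ → E3) (X : Cell 2 × ℤ) :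
    truncResidual ϱ a b w φ X = ∑' Y : Cell 2 × ℤ,
      (if Y ≠ X ∧ ‖lsite a b w Y.1 Y.2 - lsite a b w X.1 X.2‖ ≤ ϱ then
        forceConst (lsite a b w Y.1 Y.2 - lsite a b w X.1 X.2) (φ Y.1 Y.2 - φ X.1 X.2) else 0) := by
  unfold truncResidual
  refine tsum_congr fun Y => ?_
  rw [layeredKernel_sub_fst_eq]
  by_cases hYX : Y = X
  · subst hYX
    simp
  · by_cases hϱ : ϱ < ‖lsite a b w Y.1 Y.2 - lsite a b w X.1 X.2‖
    · rw [if_pos hϱ, if_neg (fun h' => not_le.mpr hϱ h'.2)]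
    · rw [if_neg hϱ, if_neg hYX, if_pos ⟨hYX, not_lt.mp hϱ⟩]

/-- the truncated residual as a FINITE index sum over any finset containing the near sites. [this file, g57] -/
theorem truncResidual_eq_sum {N : Finset (Cell 2 × ℤ)} {X : Cell 2 × ℤ} {ϱ : ℝ}
    (hN : ∀ Y : Cell 2 × ℤ, ‖lsite a b w Y.1 Y.2 - lsite a b w X.1 X.2‖ ≤ ϱ → Y ∈ N) (φ : Cell 2 → ℤ → E3) :
    truncResidual ϱ a b w φ X = ∑ Y ∈ N, (if Y ≠ X ∧ ‖lsite a b w Y.1 Y.2 - lsite a b w X.1 X.2‖ ≤ ϱ then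
      forceConst (lsite a b w Y.1 Y.2 - lsite a b w X.1 X.2) (φ Y.1 Y.2 - φ X.1 X.2) else 0) := by
  rw [truncResidual_eq_tsum_ite]
  exact tsum_eq_sum fun Y hY => if_neg fun h' => hY (hN Y h'.2)

/-- an index `tsum` supported on the near sites is a finite sum. [this file, g57] -/
theorem tsum_ite_near_eq_sum {N : Finset (Cell 2 × ℤ)} {X : Cell 2 × ℤ} {ϱ : ℝ}
    (hN : ∀ Y : Cell 2 × ℤ, ‖lsite a b w Y.1 Y.2 - lsite a b w X.1 X.2‖ ≤ ϱ → Y ∈ N) (f : Cell 2 × ℤ → E3) :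
    ∑' Y : Cell 2 × ℤ, (if Y ≠ X ∧ ‖lsite a b w Y.1 Y.2 - lsite a b w X.1 X.2‖ ≤ ϱ then f Y else 0) =
      ∑ Y ∈ N, (if Y ≠ X ∧ ‖lsite a b w Y.1 Y.2 - lsite a b w X.1 X.2‖ ≤ ϱ then f Y else 0) :=
  tsum_eq_sum fun Y hY => if_neg fun h' => hY (hN Y h'.2)

/-- ★ MODEL-SIDE RE-INDEXING: a sum over the model sites `q ≠ lsite X` within `ϱ` of `lsite X` is the finite index sum over the near sites `Y ≠ X`
(`lsite` is injective on a co-Lipschitz crystal and `Layered a b w` is its range). [this file, g57] -/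
theorem tsum_near_layered_eq_sum (hc : 0 < c) (h : IsLayeredCrystal c a b w) {X : Cell 2 × ℤ} {ϱ : ℝ} {N : Finset (Cell 2 × ℤ)}
    (hN : ∀ Y : Cell 2 × ℤ, ‖lsite a b w Y.1 Y.2 - lsite a b w X.1 X.2‖ ≤ ϱ → Y ∈ N) (g : E3 → E3) :
    ∑' q : {q : E3 // q ∈ Layered a b w ∧ q ≠ lsite a b w X.1 X.2 ∧ dist q (lsite a b w X.1 X.2) ≤ ϱ}, g q =
      ∑ Y ∈ N, (if Y ≠ X ∧ ‖lsite a b w Y.1 Y.2 - lsite a b w X.1 X.2‖ ≤ ϱ then g (lsite a b w Y.1 Y.2) else 0) := by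
  have hinj := injective_lsite_of_isLayeredCrystal hc h
  have hmem : ∀ Y : Cell 2 × ℤ, lsite a b w Y.1 Y.2 ∈ Layered a b w := fun Y => by
    rw [layered_eq_range]; exact ⟨Y, rfl⟩
  have hpt : ∀ Y : Cell 2 × ℤ,
      Set.indicator {q : E3 | q ∈ Layered a b w ∧ q ≠ lsite a b w X.1 X.2 ∧ dist q (lsite a b w X.1 X.2) ≤ ϱ} g
          (lsite a b w Y.1 Y.2) =
        if Y ≠ X ∧ ‖lsite a b w Y.1 Y.2 - lsite a b w X.1 X.2‖ ≤ ϱ then g (lsite a b w Y.1 Y.2) else 0 := by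
    intro Y
    by_cases hY : Y ≠ X ∧ ‖lsite a b w Y.1 Y.2 - lsite a b w X.1 X.2‖ ≤ ϱ
    · rw [if_pos hY]
      exact Set.indicator_of_mem
        (show lsite a b w Y.1 Y.2 ∈ {q : E3 | q ∈ Layered a b w ∧ q ≠ lsite a b w X.1 X.2 ∧ dist q (lsite a b w X.1 X.2) ≤ ϱ} from
          ⟨hmem Y, fun he => hY.1 (hinj he), by rw [dist_eq_norm]; exact hY.2⟩) g
    · rw [if_neg hY]
      refine Set.indicator_of_notMem (fun hm => hY ⟨fun he => hm.2.1 (by rw [he]), ?_⟩) g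
      rw [← dist_eq_norm]
      exact hm.2.2
  calc ∑' q : {q : E3 // q ∈ Layered a b w ∧ q ≠ lsite a b w X.1 X.2 ∧ dist q (lsite a b w X.1 X.2) ≤ ϱ}, g q
      = ∑' q : E3, Set.indicator {q : E3 | q ∈ Layered a b w ∧ q ≠ lsite a b w X.1 X.2 ∧ dist q (lsite a b w X.1 X.2) ≤ ϱ} g q :=
        tsum_subtype _ g
    _ = ∑' Y : Cell 2 × ℤ,
          Set.indicator {q : E3 | q ∈ Layered a b w ∧ q ≠ lsite a b w X.1 X.2 ∧ dist q (lsite a b w X.1 X.2) ≤ ϱ} g (lsite a b w Y.1 Y.2) := by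
        refine (hinj.tsum_eq
          (f := Set.indicator {q : E3 | q ∈ Layered a b w ∧ q ≠ lsite a b w X.1 X.2 ∧ dist q (lsite a b w X.1 X.2) ≤ ϱ} g)
          fun q hq => ?_).symm
        rw [← layered_eq_range]
        exact (Set.support_indicator_subset hq).1
    _ = ∑' Y : Cell 2 × ℤ, (if Y ≠ X ∧ ‖lsite a b w Y.1 Y.2 - lsite a b w X.1 X.2‖ ≤ ϱ then g (lsite a b w Y.1 Y.2) else 0) :=
        tsum_congr hpt
    _ = ∑ Y ∈ N, (if Y ≠ X ∧ ‖lsite a b w Y.1 Y.2 - lsite a b w X.1 X.2‖ ≤ ϱ then g (lsite a b w Y.1 Y.2) else 0) :=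
        tsum_eq_sum fun Y hY => if_neg fun h' => hY (hN Y h'.2)

/-- ★ SOURCE-SIDE RE-INDEXING: for a bijective registration `Ψ : S → Layered a b w`, a sum over the atoms `y ≠ Ψ⁻¹(lsite X)` whose images lie within `ϱ`
of `lsite X` is the finite index sum over the near sites `Y ≠ X`, the atom under `Y` being `Ψ⁻¹(lsite Y)` (`Y ↦ Ψ⁻¹(lsite Y)` is injective with
range `S`). [this file, g57] -/
theorem tsum_near_source_eq_sum (hc : 0 < c) (h : IsLayeredCrystal c a b w) {S : Set E3} {Ψ : E3 → E3}
    (hΨ : Set.BijOn Ψ S (Layered a b w)) {X : Cell 2 × ℤ} {ϱ : ℝ} {N : Finset (Cell 2 × ℤ)}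
    (hN : ∀ Y : Cell 2 × ℤ, ‖lsite a b w Y.1 Y.2 - lsite a b w X.1 X.2‖ ≤ ϱ → Y ∈ N) (g : E3 → E3) :
    ∑' y : {y : E3 // y ∈ S ∧ y ≠ Function.invFunOn Ψ S (lsite a b w X.1 X.2) ∧ dist (Ψ y) (lsite a b w X.1 X.2) ≤ ϱ}, g y =
      ∑ Y ∈ N, (if Y ≠ X ∧ ‖lsite a b w Y.1 Y.2 - lsite a b w X.1 X.2‖ ≤ ϱ then
        g (Function.invFunOn Ψ S (lsite a b w Y.1 Y.2)) else 0) := by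
  have hinj := injective_lsite_of_isLayeredCrystal hc h
  have hmem : ∀ Y : Cell 2 × ℤ, lsite a b w Y.1 Y.2 ∈ Layered a b w := fun Y => by
    rw [layered_eq_range]; exact ⟨Y, rfl⟩
  have hex : ∀ Y : Cell 2 × ℤ, ∃ s ∈ S, Ψ s = lsite a b w Y.1 Y.2 := fun Y => hΨ.surjOn (hmem Y)
  have hιS : ∀ Y : Cell 2 × ℤ, Function.invFunOn Ψ S (lsite a b w Y.1 Y.2) ∈ S := fun Y => Function.invFunOn_mem (hex Y)
  have hΨι : ∀ Y : Cell 2 × ℤ, Ψ (Function.invFunOn Ψ S (lsite a b w Y.1 Y.2)) = lsite a b w Y.1 Y.2 := fun Y =>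
    Function.invFunOn_eq (hex Y)
  have hιinj : Function.Injective (fun Y : Cell 2 × ℤ => Function.invFunOn Ψ S (lsite a b w Y.1 Y.2)) := by
    intro Y Y' hYY'
    have he : Ψ (Function.invFunOn Ψ S (lsite a b w Y.1 Y.2)) = Ψ (Function.invFunOn Ψ S (lsite a b w Y'.1 Y'.2)) :=
      congrArg Ψ hYY'
    rw [hΨι Y, hΨι Y'] at he
    exact hinj he
  have hpt : ∀ Y : Cell 2 × ℤ,
      Set.indicator {y : E3 | y ∈ S ∧ y ≠ Function.invFunOn Ψ S (lsite a b w X.1 X.2) ∧ dist (Ψ y) (lsite a b w X.1 X.2) ≤ ϱ} g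
          (Function.invFunOn Ψ S (lsite a b w Y.1 Y.2)) =
        if Y ≠ X ∧ ‖lsite a b w Y.1 Y.2 - lsite a b w X.1 X.2‖ ≤ ϱ then g (Function.invFunOn Ψ S (lsite a b w Y.1 Y.2)) else 0 := by
    intro Y
    by_cases hY : Y ≠ X ∧ ‖lsite a b w Y.1 Y.2 - lsite a b w X.1 X.2‖ ≤ ϱ
    · rw [if_pos hY]
      refine Set.indicator_of_mem
        (show Function.invFunOn Ψ S (lsite a b w Y.1 Y.2) ∈
            {y : E3 | y ∈ S ∧ y ≠ Function.invFunOn Ψ S (lsite a b w X.1 X.2) ∧ dist (Ψ y) (lsite a b w X.1 X.2) ≤ ϱ} from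
          ⟨hιS Y, fun he => hY.1 (hιinj he), ?_⟩) g
      show dist (Ψ (Function.invFunOn Ψ S (lsite a b w Y.1 Y.2))) (lsite a b w X.1 X.2) ≤ ϱ
      rw [hΨι Y, dist_eq_norm]
      exact hY.2
    · rw [if_neg hY]
      refine Set.indicator_of_notMem (fun hm => hY ⟨fun he => hm.2.1 (by rw [he]), ?_⟩) g
      have h2 : dist (Ψ (Function.invFunOn Ψ S (lsite a b w Y.1 Y.2))) (lsite a b w X.1 X.2) ≤ ϱ := hm.2.2
      rw [hΨι Y, dist_eq_norm] at h2
      exact h2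
  calc ∑' y : {y : E3 // y ∈ S ∧ y ≠ Function.invFunOn Ψ S (lsite a b w X.1 X.2) ∧ dist (Ψ y) (lsite a b w X.1 X.2) ≤ ϱ}, g y
      = ∑' y : E3, Set.indicator
          {y : E3 | y ∈ S ∧ y ≠ Function.invFunOn Ψ S (lsite a b w X.1 X.2) ∧ dist (Ψ y) (lsite a b w X.1 X.2) ≤ ϱ} g y :=
        tsum_subtype _ g
    _ = ∑' Y : Cell 2 × ℤ, Set.indicator
          {y : E3 | y ∈ S ∧ y ≠ Function.invFunOn Ψ S (lsite a b w X.1 X.2) ∧ dist (Ψ y) (lsite a b w X.1 X.2) ≤ ϱ} g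
          (Function.invFunOn Ψ S (lsite a b w Y.1 Y.2)) := by
        refine (hιinj.tsum_eq
          (f := Set.indicator
            {y : E3 | y ∈ S ∧ y ≠ Function.invFunOn Ψ S (lsite a b w X.1 X.2) ∧ dist (Ψ y) (lsite a b w X.1 X.2) ≤ ϱ} g)
          fun q hq => ?_).symm
        have hqS : q ∈ S := (Set.support_indicator_subset hq).1
        obtain ⟨Y, hY⟩ : Ψ q ∈ Set.range (fun x : Cell 2 × ℤ => lsite a b w x.1 x.2) := by
          rw [← layered_eq_range]
          exact hΨ.mapsTo hqS
        have hY' : lsite a b w Y.1 Y.2 = Ψ q := hY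
        refine ⟨Y, ?_⟩
        show Function.invFunOn Ψ S (lsite a b w Y.1 Y.2) = q
        rw [hY']
        exact hΨ.injOn.leftInvOn_invFunOn hqS
    _ = ∑' Y : Cell 2 × ℤ, (if Y ≠ X ∧ ‖lsite a b w Y.1 Y.2 - lsite a b w X.1 X.2‖ ≤ ϱ then
          g (Function.invFunOn Ψ S (lsite a b w Y.1 Y.2)) else 0) :=
        tsum_congr hpt
    _ = ∑ Y ∈ N, (if Y ≠ X ∧ ‖lsite a b w Y.1 Y.2 - lsite a b w X.1 X.2‖ ≤ ϱ then
          g (Function.invFunOn Ψ S (lsite a b w Y.1 Y.2)) else 0) :=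
        tsum_eq_sum fun Y hY => if_neg fun h' => hY (hN Y h'.2)

end NearIndex

/-! ### US.2  ★ (PT) PROVED -/

/-- ★ **(PT) `LinearisationDefectP` HOLDS** — the linearisation identity of UQ.3: truncated linearised residual of the pulled-back displacement + tail force
= −Σ second-order pair defects over the near bonds.  Proof = (1) `tailForce_eq_near_sub_near` (part TF) at the atom `Ψ⁻¹(lsite X)`; (2) the three near sums
as finite index sums (US.1); (3) the bond identity `forceConst (−z) (−v) + pairForce z − pairForce (z + v) = −defectKernel z v`, `z = lsite X − lsite Y`,
`v = φ X − φ Y`, `Ψ⁻¹(lsite X) − Ψ⁻¹(lsite Y) = z + v`. [this file, g57] -/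
theorem linearisationDefectP_holds : LinearisationDefectP := by
  intro δ hδ S hS hN c hc b₁ b₂ w hL hH hNH Ψ hΨ ϱ hϱ X
  -- the atom under the index site `X`
  have hXmem : lsite b₁ b₂ w X.1 X.2 ∈ Layered b₁ b₂ w := by
    rw [layered_eq_range]; exact ⟨X, rfl⟩
  have hex : ∃ s ∈ S, Ψ s = lsite b₁ b₂ w X.1 X.2 := hΨ.surjOn hXmem
  have hxS : Function.invFunOn Ψ S (lsite b₁ b₂ w X.1 X.2) ∈ S := Function.invFunOn_mem hex
  have hΨx : Ψ (Function.invFunOn Ψ S (lsite b₁ b₂ w X.1 X.2)) = lsite b₁ b₂ w X.1 X.2 := Function.invFunOn_eq hex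
  -- (1) the tail force is a near-field difference (part TF), read at the model site `lsite X`
  have htail := tailForce_eq_near_sub_near (Ψ := Ψ) hδ hS hN (by norm_num : (0 : ℝ) < 27 / 32) hH hNH hxS
    (by rw [hΨx]; exact hXmem) hϱ.le
  rw [hΨx] at htail
  -- (2) the near index set is finite; all four sums are finite index sums over it
  have hfin := finite_near_lsite hc hL X ϱ
  have hNmem : ∀ Y : Cell 2 × ℤ, ‖lsite b₁ b₂ w Y.1 Y.2 - lsite b₁ b₂ w X.1 X.2‖ ≤ ϱ → Y ∈ hfin.toFinset :=
    fun Y hY => hfin.mem_toFinset.mpr hY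
  have hA : (∑' q : {q : E3 // q ∈ Layered b₁ b₂ w ∧ q ≠ lsite b₁ b₂ w X.1 X.2 ∧ dist q (lsite b₁ b₂ w X.1 X.2) ≤ ϱ},
        pairForce (lsite b₁ b₂ w X.1 X.2 - q)) =
      ∑ Y ∈ hfin.toFinset, (if Y ≠ X ∧ ‖lsite b₁ b₂ w Y.1 Y.2 - lsite b₁ b₂ w X.1 X.2‖ ≤ ϱ then
        pairForce (lsite b₁ b₂ w X.1 X.2 - lsite b₁ b₂ w Y.1 Y.2) else 0) :=
    tsum_near_layered_eq_sum hc hL hNmem (fun q => pairForce (lsite b₁ b₂ w X.1 X.2 - q))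
  have hB : (∑' y : {y : E3 // y ∈ S ∧ y ≠ Function.invFunOn Ψ S (lsite b₁ b₂ w X.1 X.2) ∧
          dist (Ψ y) (lsite b₁ b₂ w X.1 X.2) ≤ ϱ}, pairForce (Function.invFunOn Ψ S (lsite b₁ b₂ w X.1 X.2) - y)) =
      ∑ Y ∈ hfin.toFinset, (if Y ≠ X ∧ ‖lsite b₁ b₂ w Y.1 Y.2 - lsite b₁ b₂ w X.1 X.2‖ ≤ ϱ then
        pairForce (Function.invFunOn Ψ S (lsite b₁ b₂ w X.1 X.2) - Function.invFunOn Ψ S (lsite b₁ b₂ w Y.1 Y.2)) else 0) :=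
    tsum_near_source_eq_sum hc hL hΨ hNmem (fun y => pairForce (Function.invFunOn Ψ S (lsite b₁ b₂ w X.1 X.2) - y))
  have hC : truncResidual ϱ b₁ b₂ w (pullDisp S Ψ b₁ b₂ w) X =
      ∑ Y ∈ hfin.toFinset, (if Y ≠ X ∧ ‖lsite b₁ b₂ w Y.1 Y.2 - lsite b₁ b₂ w X.1 X.2‖ ≤ ϱ then
        forceConst (lsite b₁ b₂ w Y.1 Y.2 - lsite b₁ b₂ w X.1 X.2) (pullDisp S Ψ b₁ b₂ w Y.1 Y.2 - pullDisp S Ψ b₁ b₂ w X.1 X.2) else 0) :=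
    truncResidual_eq_sum hNmem (pullDisp S Ψ b₁ b₂ w)
  have hD : (∑' Y : Cell 2 × ℤ, (if Y ≠ X ∧ ‖lsite b₁ b₂ w Y.1 Y.2 - lsite b₁ b₂ w X.1 X.2‖ ≤ ϱ then
        defectKernel (lsite b₁ b₂ w X.1 X.2 - lsite b₁ b₂ w Y.1 Y.2) (pullDisp S Ψ b₁ b₂ w X.1 X.2 - pullDisp S Ψ b₁ b₂ w Y.1 Y.2)
        else 0)) =
      ∑ Y ∈ hfin.toFinset, (if Y ≠ X ∧ ‖lsite b₁ b₂ w Y.1 Y.2 - lsite b₁ b₂ w X.1 X.2‖ ≤ ϱ then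
        defectKernel (lsite b₁ b₂ w X.1 X.2 - lsite b₁ b₂ w Y.1 Y.2) (pullDisp S Ψ b₁ b₂ w X.1 X.2 - pullDisp S Ψ b₁ b₂ w Y.1 Y.2)
        else 0) :=
    tsum_ite_near_eq_sum hNmem (fun Y => defectKernel (lsite b₁ b₂ w X.1 X.2 - lsite b₁ b₂ w Y.1 Y.2)
      (pullDisp S Ψ b₁ b₂ w X.1 X.2 - pullDisp S Ψ b₁ b₂ w Y.1 Y.2))
  rw [htail, hA, hB, hC, hD, ← Finset.sum_sub_distrib, ← Finset.sum_add_distrib, ← Finset.sum_neg_distrib]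
  -- (3) bond by bond
  refine Finset.sum_congr rfl fun Y _ => ?_
  by_cases hY : Y ≠ X ∧ ‖lsite b₁ b₂ w Y.1 Y.2 - lsite b₁ b₂ w X.1 X.2‖ ≤ ϱ
  · simp only [if_pos hY]
    rw [show lsite b₁ b₂ w Y.1 Y.2 - lsite b₁ b₂ w X.1 X.2 = -(lsite b₁ b₂ w X.1 X.2 - lsite b₁ b₂ w Y.1 Y.2) from (neg_sub _ _).symm,
      forceConst_neg,
      show pullDisp S Ψ b₁ b₂ w Y.1 Y.2 - pullDisp S Ψ b₁ b₂ w X.1 X.2 = -(pullDisp S Ψ b₁ b₂ w X.1 X.2 - pullDisp S Ψ b₁ b₂ w Y.1 Y.2) from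
        (neg_sub _ _).symm,
      map_neg]
    unfold defectKernel
    rw [show lsite b₁ b₂ w X.1 X.2 - lsite b₁ b₂ w Y.1 Y.2 + (pullDisp S Ψ b₁ b₂ w X.1 X.2 - pullDisp S Ψ b₁ b₂ w Y.1 Y.2) =
        Function.invFunOn Ψ S (lsite b₁ b₂ w X.1 X.2) - Function.invFunOn Ψ S (lsite b₁ b₂ w Y.1 Y.2) from by
      simp only [pullDisp]; abel]
    abel
  · simp only [if_neg hY]
    simp

end Summit.AtomisticToContinuum.Crystallization.Theorems.ChartedZeroExcessLayeredLatticeLiouville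

end
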